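import Summits.CriticalPhenomena.PercolationContinuityZ3.Theorems.PercNearOneGluingNoHeavyLowerTailAntitheticSeriesComparable
import Summits.CriticalPhenomena.PercolationContinuityZ3.Theorems.PercNearOneGluingNoHeavyLowerTailAntitheticHandleDual
import HarnessLib

/-!
# `NoHeavyLowerTail` (stmt-CriticalPhenomena-4575) — antithetic cluster pairs: **A CLIQUE PREFIX IS FREE** — CONJECTURE Δ2 / the vertex
# antithetic inequality at `R = {x}` for `K₁ ∪_c K + handle(P, Q)` whenever `(K, c)` satisfies (⊕) at `P` and (M) at `(P, Q)`, `K₁` a clique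
# through the source; and **THEOREM KKH**: two cliques sharing a cut vertex + a handle in the far clique (prim-hp-2 gen 65, HOME/MEMO-gen65.md §1)

Support file (`--supports stmt-CriticalPhenomena-4575`, hull-port prover `prim-hp-2`, gen 65).  No definitions, no named facts, no sorries;
standard axioms; no certificate.

THE GRAPH.  `E₁` a CLIQUE WITH AN ATTACHED SOURCE (pairs inside `W₁`, vertices of `W₁` other than `s` pairwise joined — e.g. the complete
graph on `W₁ ∋ s`), `E₂` any loop-free edge set glued to `E₁` at the single vertex `c` (`s` off `E₂` unless `s = c`), `P, Q ≠ s` vertices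
of the far side; arms `u 0 = P, …, u a = y`, `w 0 = Q, …, w b = z` of fresh vertices, `x` fresh joined to `y, z`, `E = E₁ ∪ E₂ ∪ arms + xy + xz`.
* `Antithetic.Clique.prefix_handle_vertex_sum_nonneg` — if `(E₂, c, P)` is ⊕-positive and `TII_{E₂}(P, Q) ≥ 0` (both dually, for the
  clusters of `c`), then for all monotone `F, G`: `0 ≤ Σ_{ω : ¬(x ∈ X_E ω ∧ x ∈ Y_E ω)} (F(X_E) − F(Y_E))(G(X_E) − G(Y_E))`.
  PROOF: `Antithetic.Series.oplus_nonneg_of_comparable` / `mixed_nonneg_of_comparable` (…AntitheticSeriesComparable: a comparable near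
  factor is transparent for series composition — `Antithetic.Clique.comparable`) feed the DUAL HANDLE THEOREM (…AntitheticHandleDual).
  So every handle theorem of the programme obtained from (⊕) + (M) of its core — K4H, W4H, B3H, K5H, KnH, the box families — survives
  PREFIXING a clique block between the source and the core (the source moves into the clique; `λ(s, ·)` of the composite is unchanged
  but no box/certificate of the composite is needed).
* `Antithetic.Clique.twoCliques_handle_vertex_sum_nonneg` — **THEOREM KKH**: `E₂` the complete graph on `W₂ ∋ c, P, Q`, meeting `W₁`
  in `c` only: `K_{m} ∪_c K_{n} + handle(P, Q)`, all `m, n`, all arm lengths ((⊕) of the far clique by `Antithetic.Complete.oplus_nonneg`,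
  (M) by the apex lemma `Antithetic.Apex.mixed_nonneg`).
[cite: VandenbergHaggstromKahn2005, §1 p. 6 ("Harris' inequality"), §1 p. 3 (open cluster `C_s`)]
-/

noncomputable section

namespace Summit.CriticalPhenomena.PercolationContinuityZ3.Theorems

open Literature.Probability.Percolation
open scoped Classical

namespace Antithetic

namespace Clique

variable {V : Type*} [Fintype V] {W₁ : Set V} {E₁ E₂ : Set (Sym2 V)} {s c P Q : V}
  (hEW : ∀ e ∈ E₁, ∀ v ∈ e, v ∈ W₁) (hclique : ∀ u ∈ W₁, ∀ v ∈ W₁, u ≠ s → v ≠ s → u ≠ v → s(u, v) ∈ E₁)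
  (hsep : ∀ e₁ ∈ E₁, ∀ e₂ ∈ E₂, ∀ v : V, v ∈ e₁ → v ∈ e₂ → v = c) (hs : ∀ e ∈ E₂, s ∈ e → s = c) (hdis : Disjoint E₁ E₂)
  (hnd : ∀ f ∈ E₁ ∪ E₂, ¬ f.IsDiag)
  (hPs : P ≠ s) (hPE : ∀ e ∈ E₁, P ∈ e → P = c) (hQs : Q ≠ s) (hQE : ∀ e ∈ E₁, Q ∈ e → Q = c)
  {u w : ℕ → V} {a b : ℕ} (hu0 : u 0 = P) (hw0 : w 0 = Q)
  (hufresh : ∀ i, 0 < i → i ≤ a → ∀ f ∈ (E₁ ∪ E₂) ∪ Cyc.edgeSet b w, u i ∈ f → f.IsDiag)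
  (hwfresh : ∀ i, 0 < i → i ≤ b → ∀ f ∈ E₁ ∪ E₂, w i ∈ f → f.IsDiag)
  (huinj : ∀ i j, i ≤ a → j ≤ a → u i = u j → i = j) (hwinj : ∀ i j, i ≤ b → j ≤ b → w i = w j → i = j)
  (hsu : ∀ i, 0 < i → i ≤ a → s ≠ u i) (hsw : ∀ i, 0 < i → i ≤ b → s ≠ w i)
  (hPw : ∀ i, 0 < i → i ≤ b → P ≠ w i) (hzu : ∀ i, 0 < i → i ≤ a → w b ≠ u i)
include hEW hclique hsep hs hdis hnd hPs hPE hQs hQE hu0 hw0 hufresh hwfresh huinj hwinj hsu hsw hPw hzu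

/-- **A clique prefix is free.**  With the notation of the module docstring: if `(E₂, c, P)` is ⊕-positive and has the mixed sum (M) at
`(P, Q)` (dually, clusters of `c` in `E₂`), then the vertex antithetic inequality at `R = {x}` holds for `E₁ ∪ E₂` plus the handle at
`(P, Q)`, for all monotone `F, G` (`H` written `arm ∪ ((E₁ ∪ E₂) ∪ stub)`). [this work] -/
theorem prefix_handle_vertex_sum_nonneg
    (hplus : ∀ K₁ K₂ : Set V → Set V → ℝ,
      (∀ ⦃A A' B B' : Set V⦄, A ⊆ A' → B' ⊆ B → K₁ A B ≤ K₁ A' B') → (∀ A B, 0 ≤ K₁ A B + K₁ B A) →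
      (∀ ⦃A A' B B' : Set V⦄, A ⊆ A' → B' ⊆ B → K₂ A B ≤ K₂ A' B') → (∀ A B, 0 ≤ K₂ A B + K₂ B A) →
      0 ≤ ∑ ω ∈ Finset.univ.filter (fun ω : Set (Sym2 V) => P ∈ openCluster (ω ∩ E₂) c),
        K₁ (openCluster (ω ∩ E₂) c) (openCluster (ωᶜ ∩ E₂) c) * K₂ (openCluster (ω ∩ E₂) c) (openCluster (ωᶜ ∩ E₂) c))
    (hmixed : ∀ K₁ K₂ : Set V → Set V → ℝ,
      (∀ ⦃A A' B B' : Set V⦄, A ⊆ A' → B' ⊆ B → K₁ A B ≤ K₁ A' B') → (∀ A B, 0 ≤ K₁ A B + K₁ B A) →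
      (∀ ⦃A A' B B' : Set V⦄, A ⊆ A' → B' ⊆ B → K₂ A B ≤ K₂ A' B') → (∀ A B, 0 ≤ K₂ A B + K₂ B A) →
      0 ≤ ∑ ω ∈ Finset.univ.filter (fun ω : Set (Sym2 V) =>
          P ∈ openCluster (ω ∩ E₂) c ∧ Q ∉ openCluster (ωᶜ ∩ E₂) c),
        K₁ (openCluster (ω ∩ E₂) c) (openCluster (ωᶜ ∩ E₂) c) * K₂ (openCluster (ω ∩ E₂) c) (openCluster (ωᶜ ∩ E₂) c))
    {x : V} (hx : ∀ f ∈ Cyc.edgeSet a u ∪ ((E₁ ∪ E₂) ∪ Cyc.edgeSet b w), x ∈ f → f.IsDiag)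
    (hxs : x ≠ s) (hxy : x ≠ u a) (hxz : x ≠ w b) (hyz : u a ≠ w b)
    (hg : s(u a, w b) ∉ Cyc.edgeSet a u ∪ ((E₁ ∪ E₂) ∪ Cyc.edgeSet b w))
    {F G : Set V → ℝ} (hF : Monotone F) (hG : Monotone G) :
    0 ≤ ∑ ω ∈ Finset.univ.filter (fun ω : Set (Sym2 V) =>
        ¬ ((openGraph (ω ∩ insert s(x, u a) (insert s(x, w b) (Cyc.edgeSet a u ∪ ((E₁ ∪ E₂) ∪ Cyc.edgeSet b w))))).Reachable s x ∧
          (openGraph (ωᶜ ∩ insert s(x, u a) (insert s(x, w b) (Cyc.edgeSet a u ∪ ((E₁ ∪ E₂) ∪ Cyc.edgeSet b w))))).Reachable s x)),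
      (F (openCluster (ω ∩ insert s(x, u a) (insert s(x, w b) (Cyc.edgeSet a u ∪ ((E₁ ∪ E₂) ∪ Cyc.edgeSet b w)))) s) -
          F (openCluster (ωᶜ ∩ insert s(x, u a) (insert s(x, w b) (Cyc.edgeSet a u ∪ ((E₁ ∪ E₂) ∪ Cyc.edgeSet b w)))) s)) *
        (G (openCluster (ω ∩ insert s(x, u a) (insert s(x, w b) (Cyc.edgeSet a u ∪ ((E₁ ∪ E₂) ∪ Cyc.edgeSet b w)))) s) -
          G (openCluster (ωᶜ ∩ insert s(x, u a) (insert s(x, w b) (Cyc.edgeSet a u ∪ ((E₁ ∪ E₂) ∪ Cyc.edgeSet b w)))) s)) := by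
  have hcomp := Clique.comparable hEW hclique (s := s)
  -- (⊕) and (M) of the composite from the far factor alone
  have hop := fun (K₁ K₂ : Set V → Set V → ℝ) hK₁ hso₁ hK₂ hso₂ =>
    Series.oplus_nonneg_of_comparable hsep hs hdis hcomp hPs hPE hplus K₁ K₂ hK₁ hso₁ hK₂ hso₂
  have hmix := fun (K₁ K₂ : Set V → Set V → ℝ) hK₁ hso₁ hK₂ hso₂ =>
    Series.mixed_nonneg_of_comparable hsep hs hdis hcomp hPs hPE hQs hQE hplus hmixed K₁ K₂ hK₁ hso₁ hK₂ hso₂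
  have h := Pendant.handle_vertex_sum_nonneg_of_oplus hnd hwfresh hwinj hsw hPw hop hu0 hw0 hufresh huinj hsu hzu hmix
    hx hxs hxy hxz hyz hg hF hG
  -- (`Decidable` instances of the event differ between the imported files; `convert` identifies them)
  convert h using 3

/-- **THEOREM KKH (two cliques sharing a cut vertex + handle).**  `E₂` the complete graph on `W₂ ∋ c, Q` (glued to the clique `E₁` at `c`
only), `P, Q ≠ s` on the far side: for all monotone `F, G` the vertex antithetic inequality at `R = {x}` holds for `E₁ ∪ E₂` plus the handle
at `(P, Q)`. [this work] -/
theorem twoCliques_handle_vertex_sum_nonneg {W₂ : Set V} (hc : c ∈ W₂) (hQ : Q ∈ W₂)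
    (hE₂ : E₂ = {e | ¬ e.IsDiag ∧ ∀ v ∈ e, v ∈ W₂})
    {x : V} (hx : ∀ f ∈ Cyc.edgeSet a u ∪ ((E₁ ∪ E₂) ∪ Cyc.edgeSet b w), x ∈ f → f.IsDiag)
    (hxs : x ≠ s) (hxy : x ≠ u a) (hxz : x ≠ w b) (hyz : u a ≠ w b)
    (hg : s(u a, w b) ∉ Cyc.edgeSet a u ∪ ((E₁ ∪ E₂) ∪ Cyc.edgeSet b w))
    {F G : Set V → ℝ} (hF : Monotone F) (hG : Monotone G) :
    0 ≤ ∑ ω ∈ Finset.univ.filter (fun ω : Set (Sym2 V) =>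
        ¬ ((openGraph (ω ∩ insert s(x, u a) (insert s(x, w b) (Cyc.edgeSet a u ∪ ((E₁ ∪ E₂) ∪ Cyc.edgeSet b w))))).Reachable s x ∧
          (openGraph (ωᶜ ∩ insert s(x, u a) (insert s(x, w b) (Cyc.edgeSet a u ∪ ((E₁ ∪ E₂) ∪ Cyc.edgeSet b w))))).Reachable s x)),
      (F (openCluster (ω ∩ insert s(x, u a) (insert s(x, w b) (Cyc.edgeSet a u ∪ ((E₁ ∪ E₂) ∪ Cyc.edgeSet b w)))) s) -
          F (openCluster (ωᶜ ∩ insert s(x, u a) (insert s(x, w b) (Cyc.edgeSet a u ∪ ((E₁ ∪ E₂) ∪ Cyc.edgeSet b w)))) s)) *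
        (G (openCluster (ω ∩ insert s(x, u a) (insert s(x, w b) (Cyc.edgeSet a u ∪ ((E₁ ∪ E₂) ∪ Cyc.edgeSet b w)))) s) -
          G (openCluster (ωᶜ ∩ insert s(x, u a) (insert s(x, w b) (Cyc.edgeSet a u ∪ ((E₁ ∪ E₂) ∪ Cyc.edgeSet b w)))) s)) := by
  -- (⊕) of the far clique from `c` (comparability) and (M) by the apex lemma (`Q ∈ W₂` is an apex of `E₂`)
  have hop := fun (K₁ K₂ : Set V → Set V → ℝ) hK₁ hso₁ hK₂ hso₂ => Complete.oplus_nonneg hc hE₂ P K₁ K₂ hK₁ hso₁ hK₂ hso₂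
  have hapex : ∀ e ∈ E₂, ∀ v ∈ e, v ≠ Q → s(v, Q) ∈ E₂ := by
    intro e he v hv hvQ
    rw [hE₂] at he ⊢
    refine ⟨by rw [Sym2.mk_isDiag_iff]; exact hvQ, fun t ht => ?_⟩
    rcases Sym2.mem_iff.1 ht with rfl | rfl
    · exact he.2 _ hv
    · exact hQ
  have hmix := fun (K₁ K₂ : Set V → Set V → ℝ) hK₁ hso₁ hK₂ hso₂ =>
    Apex.mixed_nonneg (E := E₂) (s := c) hapex P K₁ K₂ hK₁ hso₁ hK₂ hso₂
  exact prefix_handle_vertex_sum_nonneg hEW hclique hsep hs hdis hnd hPs hPE hQs hQE hu0 hw0 hufresh hwfresh huinj hwinj hsu hsw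
    hPw hzu hop hmix hx hxs hxy hxz hyz hg hF hG

end Clique

end Antithetic

end Summit.CriticalPhenomena.PercolationContinuityZ3.Theorems
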